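import Mathlib
import Summits.ValiantsHypothesis.ValiantsHypothesis.Theorems.NewtonUnitEquationsDissociatedUniformTotalsLawLifts
import Summits.ValiantsHypothesis.ValiantsHypothesis.Theorems.NewtonUnitEquationsDissociatedUniformTotalsLawLiftCount
import HarnessLib

/-!
# Crux `NewtonUnitEquations.DissociatedUniform` (stmt-ValiantsHypothesis-5905): the UNIFORM pointwise union bound for co-oriented strictly convex pairs

Companion of `…TotalsLawLifts` (monotone mode lifts along an abstract chart for left-turning curves) and `…TotalsLawLiftCount`
(`unionVert_le_of_lifts`: co-monotone lifts on both charts ⇒ `#vert conv U_s(Z) ≤ 12q`).  Here the two are assembled: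

* `LeftTurning a` / `RightTurning a`: `det(a(z+1) − a z, a(z+2) − a(z+1)) > 0` (resp. `< 0`) at every label — strictly convex polygons
  traversed counter-clockwise (resp. clockwise) with no three consecutive collinear points;
* `exists_lifts_of_leftTurning` / `exists_lifts_of_rightTurning`: the two charts `(1, t)`, `(-1, t)` of such a curve are the abstract
  families `(±a·0) + s·(±a·1)` at `s = ±t`, all left-turning, so `exists_forward_lift` gives monotone lifts with the time reparametrisations
  `id` / `t ↦ -t` — the SAME pair of reparametrisations for two curves of the same turning direction;
* **`unionVert_le_twelve_mul`**: for `a`, `b` convexly ordered, injective, both left-turning or both right-turning, and EVERY `Z`, `s`: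
  `#vert conv U_s(Z) ≤ 12·q`.  This is the located rung of memo NOTES-t1g5 §4(C) (`ConvexUnionVertBound`) on the co-oriented strictly
  convex part of the stratum, with a corrected constant: the constant `2` is FALSE (`…TotalsLawConvexUnionSharpness`), the truth for such
  pairs is `4q − 2|Z|` (memo NOTES-t1g6 §3, attained), `12` is what the crude per-chart lap count gives.
* `unionTotal_le_twelve_mul_sq` (`UT ≤ 12q²`) and `totalVert_le_of_coOriented` (the `n = 3` class law `T ≤ 12·m·q²` for an `m`-valued
  third curve over such a pair).
What is NOT here: contra-oriented pairs (one curve left-, one right-turning: the chains slide instead of nesting, memo §3 (K2)), degenerate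
convexly ordered pairs (collinear triples), general labellings.
Honest label: a stratum theorem; `ConvexUnionVertBound C` (all convexly ordered pairs, `C ≥ 3`), `UnionTotalsLaw`, `TotalsLawThree` remain
OPEN; nothing here bears on VP ≠ VNP.
[folklore]
-/

set_option linter.dupNamespace false -- `ValiantsHypothesis.ValiantsHypothesis` (summit = problem) in every name

open scoped BigOperators Pointwise

namespace Summit.ValiantsHypothesis.ValiantsHypothesis.Theorems.NewtonUnitEquationsDissociatedUniform

namespace TotalsLaw

open Literature.Computability.AlgebraicComplexity.KPTT.PlanarMinkowski

section LeftTurning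

variable {q : ℕ} [NeZero q]

/-- The curve `a : ℤ/q → ℝ²` TURNS LEFT at every label: `det(a(z+1) − a z, a(z+2) − a(z+1)) > 0` (strictly convex, counter-clockwise,
no three consecutive points collinear). [folklore] -/
def LeftTurning (a : ZMod q → (Fin 2 → ℝ)) : Prop :=
  ∀ z : ZMod q, 0 < (a (z + 1) 0 - a z 0) * (a (z + 2) 1 - a (z + 1) 1) - (a (z + 1) 1 - a z 1) * (a (z + 2) 0 - a (z + 1) 0)

/-- The curve TURNS RIGHT at every label (clockwise): `det(a(z+1) − a z, a(z+2) − a(z+1)) < 0`. [folklore] -/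
def RightTurning (a : ZMod q → (Fin 2 → ℝ)) : Prop :=
  ∀ z : ZMod q, (a (z + 1) 0 - a z 0) * (a (z + 2) 1 - a (z + 1) 1) - (a (z + 1) 1 - a z 1) * (a (z + 2) 0 - a (z + 1) 0) < 0

variable (a : ZMod q → (Fin 2 → ℝ))

/-- A strict top of `A` at a chart weight is a strict maximiser over LABELS of the chart function (injective curve). [folklore] -/
theorem labelMode_of_isStrictTop (hai : Function.Injective a) {σ t : ℝ} {x : ZMod q}
    (htop : IsStrictTop ![σ, t] (Finset.univ.image a) (a x)) :
    ∀ z : ZMod q, z ≠ x → σ * a z 0 + t * a z 1 < σ * a x 0 + t * a x 1 := by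
  classical
  intro z hz
  have h := htop.2 (a z) (Finset.mem_image_of_mem a (Finset.mem_univ z)) (fun he => hz (hai he))
  rwa [chart_dotProduct, chart_dotProduct] at h

/-- **Lifts of a left-turning curve**: on the chart `σ = 1` the strict modes are `x₀ + P t`, on the chart `σ = -1` they are `x₀' + P' (-t)`,
with `P, P' : ℝ → ℕ` monotone and `< q`. [folklore] -/
theorem exists_lifts_of_leftTurning (ha : ConvexlyOrdered a) (hai : Function.Injective a) (hL : LeftTurning a) :
    (∃ (x₀ : ZMod q) (P : ℝ → ℕ), Monotone P ∧ (∀ t, P t < q) ∧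
      ∀ (t : ℝ) (x : ZMod q), IsStrictTop ![1, t] (Finset.univ.image a) (a x) → x = x₀ + (P t : ZMod q)) ∧
    (∃ (x₀ : ZMod q) (P : ℝ → ℕ), Monotone P ∧ (∀ t, P t < q) ∧
      ∀ (t : ℝ) (x : ZMod q), IsStrictTop ![-1, t] (Finset.univ.image a) (a x) → x = x₀ + (P (-t) : ZMod q)) := by
  constructor
  · -- chart `1`: the family `a·0 + t·a·1`
    have hcu : ∀ t : ℝ, CycUnimodal fun z => a z 0 + t * a z 1 := fun t => by
      obtain ⟨n, d, hnd⟩ := ha ![1, t]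
      refine ⟨n, d, ?_⟩
      have : (fun z => ![1, t] ⬝ᵥ a z) = fun z => a z 0 + t * a z 1 := by
        funext z; rw [chart_dotProduct, one_mul]
      rw [← this]; exact hnd
    have hh : CycUnimodal fun z => a z 1 := by
      obtain ⟨n, d, hnd⟩ := ha ![0, 1]
      refine ⟨n, d, ?_⟩
      have : (fun z => ![0, 1] ⬝ᵥ a z) = fun z => a z 1 := by
        funext z; rw [chart_dotProduct, zero_mul, one_mul, zero_add]
      rw [← this]; exact hnd
    obtain ⟨x₀, P, hP, hPq, hmode⟩ := exists_forward_lift (fun z => a z 0) (fun z => a z 1) hcu hh hL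
    refine ⟨x₀, P, hP, hPq, fun t x htop => hmode t x fun z hz => ?_⟩
    have := labelMode_of_isStrictTop a hai htop z hz
    simpa only [one_mul] using this
  · -- chart `-1`: the point-reflected family `-a·0 + s·(-a·1)` at `s = -t`
    have hcu : ∀ s : ℝ, CycUnimodal fun z => -a z 0 + s * -a z 1 := fun s => by
      obtain ⟨n, d, hnd⟩ := ha ![-1, -s]
      refine ⟨n, d, ?_⟩
      have : (fun z => ![-1, -s] ⬝ᵥ a z) = fun z => -a z 0 + s * -a z 1 := by
        funext z; rw [chart_dotProduct]; ring
      rw [← this]; exact hnd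
    have hh : CycUnimodal fun z => -a z 1 := by
      obtain ⟨n, d, hnd⟩ := ha ![0, -1]
      refine ⟨n, d, ?_⟩
      have : (fun z => ![0, -1] ⬝ᵥ a z) = fun z => -a z 1 := by
        funext z; rw [chart_dotProduct]; ring
      rw [← this]; exact hnd
    have hL' : ∀ z : ZMod q, 0 < (-a (z + 1) 0 - -a z 0) * (-a (z + 2) 1 - -a (z + 1) 1) -
        (-a (z + 1) 1 - -a z 1) * (-a (z + 2) 0 - -a (z + 1) 0) := fun z => by
      have := hL z; linarith
    obtain ⟨x₀, P, hP, hPq, hmode⟩ := exists_forward_lift (fun z => -a z 0) (fun z => -a z 1) hcu hh hL'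
    refine ⟨x₀, P, hP, hPq, fun t x htop => hmode (-t) x fun z hz => ?_⟩
    have := labelMode_of_isStrictTop a hai htop z hz
    linarith

/-- **Lifts of a right-turning curve**: on the chart `σ = 1` the strict modes are `x₀ + P (-t)`, on the chart `σ = -1` they are
`x₀' + P' t`. [folklore] -/
theorem exists_lifts_of_rightTurning (ha : ConvexlyOrdered a) (hai : Function.Injective a) (hR : RightTurning a) :
    (∃ (x₀ : ZMod q) (P : ℝ → ℕ), Monotone P ∧ (∀ t, P t < q) ∧
      ∀ (t : ℝ) (x : ZMod q), IsStrictTop ![1, t] (Finset.univ.image a) (a x) → x = x₀ + (P (-t) : ZMod q)) ∧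
    (∃ (x₀ : ZMod q) (P : ℝ → ℕ), Monotone P ∧ (∀ t, P t < q) ∧
      ∀ (t : ℝ) (x : ZMod q), IsStrictTop ![-1, t] (Finset.univ.image a) (a x) → x = x₀ + (P t : ZMod q)) := by
  constructor
  · -- chart `1`: the family `a·0 + s·(-a·1)` at `s = -t` (vertical reflection turns right into left)
    have hcu : ∀ s : ℝ, CycUnimodal fun z => a z 0 + s * -a z 1 := fun s => by
      obtain ⟨n, d, hnd⟩ := ha ![1, -s]
      refine ⟨n, d, ?_⟩
      have : (fun z => ![1, -s] ⬝ᵥ a z) = fun z => a z 0 + s * -a z 1 := by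
        funext z; rw [chart_dotProduct]; ring
      rw [← this]; exact hnd
    have hh : CycUnimodal fun z => -a z 1 := by
      obtain ⟨n, d, hnd⟩ := ha ![0, -1]
      refine ⟨n, d, ?_⟩
      have : (fun z => ![0, -1] ⬝ᵥ a z) = fun z => -a z 1 := by
        funext z; rw [chart_dotProduct]; ring
      rw [← this]; exact hnd
    have hL' : ∀ z : ZMod q, 0 < (a (z + 1) 0 - a z 0) * (-a (z + 2) 1 - -a (z + 1) 1) -
        (-a (z + 1) 1 - -a z 1) * (a (z + 2) 0 - a (z + 1) 0) := fun z => by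
      have := hR z; linarith
    obtain ⟨x₀, P, hP, hPq, hmode⟩ := exists_forward_lift (fun z => a z 0) (fun z => -a z 1) hcu hh hL'
    refine ⟨x₀, P, hP, hPq, fun t x htop => hmode (-t) x fun z hz => ?_⟩
    have := labelMode_of_isStrictTop a hai htop z hz
    linarith
  · -- chart `-1`: the family `-a·0 + t·a·1` (horizontal reflection)
    have hcu : ∀ t : ℝ, CycUnimodal fun z => -a z 0 + t * a z 1 := fun t => by
      obtain ⟨n, d, hnd⟩ := ha ![-1, t]
      refine ⟨n, d, ?_⟩
      have : (fun z => ![-1, t] ⬝ᵥ a z) = fun z => -a z 0 + t * a z 1 := by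
        funext z; rw [chart_dotProduct]; ring
      rw [← this]; exact hnd
    have hh : CycUnimodal fun z => a z 1 := by
      obtain ⟨n, d, hnd⟩ := ha ![0, 1]
      refine ⟨n, d, ?_⟩
      have : (fun z => ![0, 1] ⬝ᵥ a z) = fun z => a z 1 := by
        funext z; rw [chart_dotProduct, zero_mul, one_mul, zero_add]
      rw [← this]; exact hnd
    have hL' : ∀ z : ZMod q, 0 < (-a (z + 1) 0 - -a z 0) * (a (z + 2) 1 - a (z + 1) 1) -
        (a (z + 1) 1 - a z 1) * (-a (z + 2) 0 - -a (z + 1) 0) := fun z => by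
      have := hR z; linarith
    obtain ⟨x₀, P, hP, hPq, hmode⟩ := exists_forward_lift (fun z => -a z 0) (fun z => a z 1) hcu hh hL'
    refine ⟨x₀, P, hP, hPq, fun t x htop => hmode t x fun z hz => ?_⟩
    have := labelMode_of_isStrictTop a hai htop z hz
    linarith

variable (b : ZMod q → (Fin 2 → ℝ))

/-- **The uniform pointwise bound for co-oriented strictly convex pairs.**  If `a` and `b` are convexly ordered, injective and BOTH
left-turning or BOTH right-turning, then EVERY union of fibres has at most `12·q` hull vertices: `#vert conv U_s(Z) ≤ 12·q` for all
position sets `Z` and classes `s` — the located rung of memo NOTES-t1g5 §4(C) with a corrected constant (the constant `2` is false,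
`…TotalsLawConvexUnionSharpness`; the truth for such pairs is `4q − 2|Z|`, memo NOTES-t1g6 §3), unconditional on this stratum.
[folklore] -/
theorem unionVert_le_twelve_mul (ha : ConvexlyOrdered a) (hb : ConvexlyOrdered b) (hai : Function.Injective a)
    (hbi : Function.Injective b) (hturn : (LeftTurning a ∧ LeftTurning b) ∨ (RightTurning a ∧ RightTurning b))
    (Z : Finset (ZMod q)) (s : ZMod q) : unionVert a b (Z : Set (ZMod q)) s ≤ 12 * q := by
  refine unionVert_le_of_lifts a b ha hb Z s fun σ hσ => ?_
  rcases hturn with ⟨hLa, hLb⟩ | ⟨hRa, hRb⟩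
  · obtain ⟨⟨x₀, P, hP, hPq, hPA⟩, ⟨x₀', P', hP', hP'q, hPA'⟩⟩ := exists_lifts_of_leftTurning a ha hai hLa
    obtain ⟨⟨y₀, Q, hQ, hQq, hQB⟩, ⟨y₀', Q', hQ', hQ'q, hQB'⟩⟩ := exists_lifts_of_leftTurning b hb hbi hLb
    rcases hσ with rfl | rfl
    · exact ⟨ℝ, inferInstance, inferInstance, id, x₀, y₀, P, Q, hP, hQ, hPq, hQq, hPA, hQB⟩
    · exact ⟨ℝ, inferInstance, inferInstance, fun t => -t, x₀', y₀', P', Q', hP', hQ', hP'q, hQ'q, hPA', hQB'⟩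
  · obtain ⟨⟨x₀, P, hP, hPq, hPA⟩, ⟨x₀', P', hP', hP'q, hPA'⟩⟩ := exists_lifts_of_rightTurning a ha hai hRa
    obtain ⟨⟨y₀, Q, hQ, hQq, hQB⟩, ⟨y₀', Q', hQ', hQ'q, hQB'⟩⟩ := exists_lifts_of_rightTurning b hb hbi hRb
    rcases hσ with rfl | rfl
    · exact ⟨ℝ, inferInstance, inferInstance, fun t => -t, x₀, y₀, P, Q, hP, hQ, hPq, hQq, hPA, hQB⟩
    · exact ⟨ℝ, inferInstance, inferInstance, id, x₀', y₀', P', Q', hP', hQ', hP'q, hQ'q, hPA', hQB'⟩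

/-- **The union totals law for co-oriented strictly convex pairs**: `unionTotal a b Z ≤ 12·q²` for every position set. [folklore] -/
theorem unionTotal_le_twelve_mul_sq (ha : ConvexlyOrdered a) (hb : ConvexlyOrdered b) (hai : Function.Injective a)
    (hbi : Function.Injective b) (hturn : (LeftTurning a ∧ LeftTurning b) ∨ (RightTurning a ∧ RightTurning b))
    (Z : Finset (ZMod q)) : unionTotal a b (Z : Set (ZMod q)) ≤ 12 * q ^ 2 := by
  unfold unionTotal
  calc ∑ s, unionVert a b (Z : Set (ZMod q)) s ≤ ∑ _s : ZMod q, 12 * q :=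
        Finset.sum_le_sum fun s _ => unionVert_le_twelve_mul a b ha hb hai hbi hturn Z s
    _ = 12 * q ^ 2 := by rw [Finset.sum_const, Finset.card_univ, ZMod.card, smul_eq_mul]; ring

/-- **The `n = 3` class law on this stratum**: a third curve with at most `m` values over a co-oriented strictly convex pair has
`T(a, b, c) ≤ 12·m·q²` (level-set decomposition `totalVert_le_sum_unionTotal`). [folklore] -/
theorem totalVert_le_of_coOriented (ha : ConvexlyOrdered a) (hb : ConvexlyOrdered b) (hai : Function.Injective a)
    (hbi : Function.Injective b) (hturn : (LeftTurning a ∧ LeftTurning b) ∨ (RightTurning a ∧ RightTurning b))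
    (c : ZMod q → (Fin 2 → ℝ)) [DecidableEq (Fin 2 → ℝ)] {m : ℕ} (hm : (Finset.univ.image c).card ≤ m) :
    totalVert a b c ≤ 12 * m * q ^ 2 := by
  classical
  have hlevel : ∀ v : Fin 2 → ℝ, unionTotal a b (c ⁻¹' {v}) ≤ 12 * q ^ 2 := by
    intro v
    have hset : (c ⁻¹' {v} : Set (ZMod q)) = ((Finset.univ.filter fun z => c z = v : Finset (ZMod q)) : Set (ZMod q)) := by
      ext z; simp
    rw [hset]
    exact unionTotal_le_twelve_mul_sq a b ha hb hai hbi hturn _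
  calc totalVert a b c ≤ ∑ v ∈ Finset.univ.image c, unionTotal a b (c ⁻¹' {v}) := totalVert_le_sum_unionTotal a b c
    _ ≤ ∑ _v ∈ Finset.univ.image c, 12 * q ^ 2 := Finset.sum_le_sum fun v _ => hlevel v
    _ = (Finset.univ.image c).card * (12 * q ^ 2) := by rw [Finset.sum_const, smul_eq_mul]
    _ ≤ m * (12 * q ^ 2) := Nat.mul_le_mul_right _ hm
    _ = 12 * m * q ^ 2 := by ring

end LeftTurning

end TotalsLaw

end Summit.ValiantsHypothesis.ValiantsHypothesis.Theorems.NewtonUnitEquationsDissociatedUniform
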